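import Summits.QuantumFields.YangMills.Theorems.FluctuationComparisonRegPrIntLOrganTangentNearFamilyStability
import HarnessLib

/-!
# Crux `FluctuationComparisonRegPrIntL` (stmt-QuantumFields-20520, rung R3), PATH-B organ — «GOOD-SET MARGIN»: on the reduced-threshold good set every
# transported corner (and every family point) of a near coarse square lies in the SEED's window (DISCHARGE-SPEC v1.8 (xv-b) «A5 TAIL THRESHOLD», companion lemma;
# LEAD `ym-ust-20520-w3` g28 №28; DEFINITION-FREE)

Cell `ym3-torus` (YM ladder rung R3 = continuum `SU(2)` Yang–Mills on the three-torus — a RUNG: NOT d = 4, NOT infinite volume, NOT a mass gap, NOT Clay).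
Width seat `ym-ust-20520-w4` (gen 26); `--kind proof --supports stmt-QuantumFields-20520 --as helper`, count-neutral, no registry ∕ binder ∕ `Lines/` edit, default
heartbeats, `autoImplicit false`.  Over ✓p820913 `…OrganTangentNearFamilyStability` (`dist1_chart_family_corner_le`), ✓p819195 `…OrganTangentNearDisplacement`
(`dist1_chart_corner_corner_le`, `plaqSmall_of_near`), ✓`…OrganTangentILawKnitFacts.plaqSmall_mono`, ✓`…OrganTangentRelPathWindow.plaqSmall_relPath_of_le`,
✓`…OrganTangentNearStability.guard8_of_guard16`.

WHY (w4 g26 (P2) probe, watch-item (W); LEAD №28 booked as SPEC (xv-b)).  The SEED of ROW-sq v0.4 (`…RunpairOrganDischargeInputsHJsqV04.OrganDischargeInputsHJsq`) speaks about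
`h_Ts = log ρ_Ts − log ρ′_Ts` on the `θBal_Ts∕4`-window only, while the A5 good-set clause `hG` evaluates `h_Ts∘Φ(·, z)` at the transported corners `Φ(U,z), Φ(V,z), Φ(W,z), Φ(Y,z)`
of an admissible near coarse square for `z ∈ Good ∧ ŵ_t(Xw, z) ≠ 0`, i.e. anywhere in the `24∕25·θBal_Ts`-window.  The discharger's only way to invoke the seed is to SHRINK the good
set to `Good := {z | Φ(Xw, z) ∈ PlaqSmall (θBal_Ts∕4 − 3·(Db·rc))}` and pay the annulus with the tail letter `ES`.  This file is the kernel check that this `Good` does its job: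
from the (I-geo)sq clause `hdisp` (letters `DP ≤ Db`, moves `‖v‖ ≤ rc·θ_j∕4`) every corner of the square is within THREE admissible moves of every other corner (the tree's
corner table: `W ↔ Y` costs three when `B = B′`), so a margin of `3·(Db·rc)` at the law corner `Xw` puts all four transported corners — and every point of the one-bond
exponential family `(s,t) ∈ [0,1]²` — inside `PlaqSmall (θBal_Ts∕4)`.  (room₃ `24∕25·θBal_Ts + 3·(Db·rc) ≤ c·θBal_Ts`, `c < 1`, gives `3·Db·rc < θBal_Ts∕75`, so the reduced
threshold is positive; not needed for the statements, which are vacuous when it is not.)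
* §1 (generic chart `T`, thresholds `θc, θc′, θ₀`): ★`plaqSmall_corner_of_margin` (corner `Xw` with `T Xw ∈ PlaqSmall (θ₀ − 3·(Db·rc))` ⟹ every corner `X` has
  `T X ∈ PlaqSmall θ₀`), ★`plaqSmall_family_of_margin` (⟹ every family point, given the partial point `U·e^{sm}@b` in the coarse `θc′`-window).
* §2 (T³ record, the row-sq's `hdisp` binder text VERBATIM with `z` first, `θ₀ := θBal_Ts∕4`): ★★`plaqSmall_corners_of_good`, ★★`plaqSmall_family_of_good` (the latter under the
  window guard `(1 + 16·√3·rc)·(θ_j∕4) ≤ θ_j` of ✓p819252, which keeps the partial point in the `θ_j`-window).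
INHABITATION (★★OWNER RULING №100): LAW-FREE (pure `dist1`∕`Function.update` bookkeeping over the HYPOTHESIS clause `hdisp`; no fibre law, no score).

HONEST FRAMING: bookkeeping over a HYPOTHESIS clause; the displacement letters `DP` of Bałaban's minimiser-following chart ([Balaban1985Variational] Thm 1 (10) p.279, Prop 9
(190) p.309) are NOT constructed; the tail estimate for the annulus (SPEC (xv-b): conditional fibre law, threshold `θBal_Ts∕4`, [Balaban1985UV3] (71)) is NOT touched; nothing
of Bałaban's analysis is asserted or proved; `SpreadFibreLawH(J)(sq)` ∕ `OrganDischargeInputsHJ(sq)` v0.1–v0.4 are HYPOTHESIS rows, UNDISCHARGED; O1ᵘ-H, S1aᴴ, S2α′, S2β,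
26243, the five registered stubs of `Lines/semiclassical_s2beta.lean` (registry 3732b7df untouched), crux 20520 `FluctuationComparisonRegPrIntL` and `YM3TorusSU2` are NOT
proved; no summit ∕ sub-problem statement is proved by a helper; rung R3 = SU(2) YM₃ on T³ at fixed lattice data — NOT d = 4, NOT infinite volume, NOT a mass gap, NOT Clay;
the Yang–Mills mass gap is NOT proved.  [folklore]
-/

set_option autoImplicit false

noncomputable section

namespace Summit.QuantumFields.YangMills.Theorems.OrganTangentGoodSetMargin

open Function Set
open Literature.MathematicalPhysics.QuantumFieldTheory.Balaban1983to89
open T4CubeChartExp (expPt)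
open Summit.QuantumFields.YangMills.Theorems.OrganTangentNearDisplacement (dist1_chart_corner_corner_le plaqSmall_of_near)
open Summit.QuantumFields.YangMills.Theorems.OrganTangentNearFamilyStability (dist1_chart_family_corner_le)
open Summit.QuantumFields.YangMills.Theorems.OrganTangentILawKnitFacts (plaqSmall_mono abs_le_two_of_mem_Icc)
open Summit.QuantumFields.YangMills.Theorems.OrganTangentRelPathWindow (plaqSmall_relPath_of_le)
open Summit.QuantumFields.YangMills.Theorems.OrganTangentNearStability (guard8_of_guard16)

/-! ## §1 Generic chart: a `3·(Db·rc)` margin at one corner covers the whole square -/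

section Generic

variable {P Q : Params} {j i : ℕ} [DecidableEq (PBond P j)]

/-- ★ **CORNERS.**  Under the one-bond displacement clause `hdisp` (coarse `θc′`-window, letters `DP ≤ Db`, moves `‖v‖ ≤ rc·θc`), for an admissible square
`V = U·e^v@b, W = U·e^{v′}@b′, Y = V·e^{v′}@b′` with all corners in the `θc′`-window: if the image of ONE corner `Xw` is `(θ₀ − 3·(Db·rc))`-small then the image of
EVERY corner `X` is `θ₀`-small (✓`dist1_chart_corner_corner_le` + ✓`plaqSmall_of_near`). [folklore] -/
theorem plaqSmall_corner_of_margin {θc θc' rc Db θ₀ : ℝ} (hθc : 0 < θc) (hrc : 0 ≤ rc)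
    (T : GaugeField P j (Matrix.specialUnitaryGroup (Fin 2) ℂ) → GaugeField Q i (Matrix.specialUnitaryGroup (Fin 2) ℂ))
    (DP : Plaq Q i → PBond P j → ℝ)
    (hdisp : ∀ (U : GaugeField P j (Matrix.specialUnitaryGroup (Fin 2) ℂ)), PlaqSmall θc' U →
      ∀ (b : PBond P j) (v : Fin 3 → ℝ), ‖v‖ ≤ rc * θc → ∀ s ∈ Icc (0 : ℝ) 1, ∀ p : Plaq Q i,
        dist1 (GaugeField.plaqHol (T (update U b (U b * expPt (s • v)))) p)
          ≤ dist1 (GaugeField.plaqHol (T U) p) + DP p b * (‖v‖ / θc))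
    (hDb0 : 0 ≤ Db) (hDb : ∀ p b, DP p b ≤ Db)
    {b b' : PBond P j} {v v' : Fin 3 → ℝ} {U V W Y : GaugeField P j (Matrix.specialUnitaryGroup (Fin 2) ℂ)}
    (hv : ‖v‖ ≤ rc * θc) (hv' : ‖v'‖ ≤ rc * θc)
    (hU : PlaqSmall θc' U) (hV : PlaqSmall θc' V) (hW : PlaqSmall θc' W) (hY : PlaqSmall θc' Y)
    (hVoff : ∀ e, e ≠ b → V e = U e) (hVon : V b = U b * expPt v) (hWoff : ∀ e, e ≠ b' → W e = U e) (hWon : W b' = U b' * expPt v')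
    (hYoff : ∀ e, e ≠ b' → Y e = V e) (hYon : Y b' = V b' * expPt v')
    {X Xw : GaugeField P j (Matrix.specialUnitaryGroup (Fin 2) ℂ)}
    (hX : X = U ∨ X = V ∨ X = W ∨ X = Y) (hXw : Xw = U ∨ Xw = V ∨ Xw = W ∨ Xw = Y)
    (hTXw : PlaqSmall (θ₀ - 3 * (Db * rc)) (T Xw)) :
    PlaqSmall θ₀ (T X) := by
  have h := plaqSmall_of_near
    (fun p => dist1_chart_corner_corner_le hθc hrc T DP hdisp hDb0 hDb hv hv' hU hV hW hY hVoff hVon hWoff hWon hYoff hYon hX hXw p) hTXw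
  exact plaqSmall_mono (by linarith) h

/-- ★ **FAMILY POINTS.**  Same setting; if moreover the partial point `U·e^{s v}@b` lies in the coarse `θc′`-window, then for `(s,t) ∈ [0,1]²` the image of the family
point `sq U b v b′ v′ s t = (U·e^{sv}@b)·e^{tv′}@b′` is `θ₀`-small as soon as the image of one corner `Xw` is `(θ₀ − 3·(Db·rc))`-small
(✓`dist1_chart_family_corner_le` + ✓`plaqSmall_of_near`). [folklore] -/
theorem plaqSmall_family_of_margin {θc θc' rc Db θ₀ : ℝ} (hθc : 0 < θc) (hrc : 0 ≤ rc)
    (T : GaugeField P j (Matrix.specialUnitaryGroup (Fin 2) ℂ) → GaugeField Q i (Matrix.specialUnitaryGroup (Fin 2) ℂ))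
    (DP : Plaq Q i → PBond P j → ℝ)
    (hdisp : ∀ (U : GaugeField P j (Matrix.specialUnitaryGroup (Fin 2) ℂ)), PlaqSmall θc' U →
      ∀ (b : PBond P j) (v : Fin 3 → ℝ), ‖v‖ ≤ rc * θc → ∀ s ∈ Icc (0 : ℝ) 1, ∀ p : Plaq Q i,
        dist1 (GaugeField.plaqHol (T (update U b (U b * expPt (s • v)))) p)
          ≤ dist1 (GaugeField.plaqHol (T U) p) + DP p b * (‖v‖ / θc))
    (hDb0 : 0 ≤ Db) (hDb : ∀ p b, DP p b ≤ Db)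
    {b b' : PBond P j} {v v' : Fin 3 → ℝ} {U V W Y : GaugeField P j (Matrix.specialUnitaryGroup (Fin 2) ℂ)}
    (hv : ‖v‖ ≤ rc * θc) (hv' : ‖v'‖ ≤ rc * θc)
    (hU : PlaqSmall θc' U) (hV : PlaqSmall θc' V) (hW : PlaqSmall θc' W) (hY : PlaqSmall θc' Y)
    (hVoff : ∀ e, e ≠ b → V e = U e) (hVon : V b = U b * expPt v) (hWoff : ∀ e, e ≠ b' → W e = U e) (hWon : W b' = U b' * expPt v')
    (hYoff : ∀ e, e ≠ b' → Y e = V e) (hYon : Y b' = V b' * expPt v')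
    {s t : ℝ} (hs : s ∈ Icc (0 : ℝ) 1) (ht : t ∈ Icc (0 : ℝ) 1)
    (hmid : PlaqSmall θc' (update U b (U b * expPt (s • v))))
    {Xw : GaugeField P j (Matrix.specialUnitaryGroup (Fin 2) ℂ)} (hXw : Xw = U ∨ Xw = V ∨ Xw = W ∨ Xw = Y)
    (hTXw : PlaqSmall (θ₀ - 3 * (Db * rc)) (T Xw)) :
    PlaqSmall θ₀ (T (update (update U b (U b * expPt (s • v))) b' ((update U b (U b * expPt (s • v))) b' * expPt (t • v')))) := by
  have h := plaqSmall_of_near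
    (fun p => dist1_chart_family_corner_le hθc hrc T DP hdisp hDb0 hDb hv hv' hU hV hW hY hVoff hVon hWoff hWon hYoff hYon hs ht hmid hXw p)
    hTXw
  exact plaqSmall_mono (by linarith) h

end Generic

/-! ## §2 At the T³ record: the row-sq's `hdisp` binder text, `θ₀ := θBal_Ts∕4` (the SEED's window) -/

open T3ContinuumYM3Torus T3NestedUnitLaws T3UnitLawDensityEML T4Continuum BalabanUVClass T3UnitScaleTilt T3LevelShift T3TiltDescent

/-- ★★ **GOOD-SET MARGIN, CORNERS (T³ record).**  Under ROW-sq v0.4's (I-geo)sq displacement clause `hdisp` VERBATIM (letters `DP ≤ Db`, `0 ≤ Db`, `0 ≤ rc`, `0 < θBal_j`),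
for every fibre point `z`, every admissible near coarse square `(U V W Y; B m, B′ m′)` in the `θ_j∕4`-window and every pair of corners `X, Xw`:
`Φ(Xw, z) ∈ PlaqSmall (θBal_Ts∕4 − 3·(Db·rc)) ⟹ Φ(X, z) ∈ PlaqSmall (θBal_Ts∕4)` — on `Good := {z | Φ(Xw,z) ∈ PlaqSmall(θBal_Ts∕4 − 3·(Db·rc))}` all four transported
corners sit in the SEED's window. [folklore] -/
theorem plaqSmall_corners_of_good (F : T3Family) (γ b₀ p₀ : ℝ) (j Ts : ℕ)
    {Z : Type} (Φ : GaugeField (F.P j) 0 ↥(Matrix.specialUnitaryGroup (Fin 2) ℂ) × Z → GaugeField (F.P Ts) 0 ↥(Matrix.specialUnitaryGroup (Fin 2) ℂ))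
    (hθj : 0 < θBal F.L γ b₀ p₀ j) (Db rc : ℝ) (hrc : 0 ≤ rc) (hDb0 : 0 ≤ Db) (DP : Plaq (F.P Ts) 0 → PBond (F.P j) 0 → ℝ) (hDb : ∀ p b, DP p b ≤ Db)
    (hdisp : ∀ (z : Z) (X : GaugeField (F.P j) 0 ↥(Matrix.specialUnitaryGroup (Fin 2) ℂ)), PlaqSmall (θBal F.L γ b₀ p₀ j) X →
      ∀ (b : PBond (F.P j) 0) (v : Fin 3 → ℝ), ‖v‖ ≤ rc * (θBal F.L γ b₀ p₀ j / 4) → ∀ s ∈ Icc (0 : ℝ) 1, ∀ p : Plaq (F.P Ts) 0,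
        dist1 (GaugeField.plaqHol (Φ (update X b (X b * expPt (s • v)), z)) p)
          ≤ dist1 (GaugeField.plaqHol (Φ (X, z)) p) + DP p b * (‖v‖ / (θBal F.L γ b₀ p₀ j / 4))) :
    ∀ (z : Z) (B B' : PBond (F.P j) 0) (m m' : Fin 3 → ℝ) (U V W Y : GaugeField (F.P j) 0 ↥(Matrix.specialUnitaryGroup (Fin 2) ℂ)),
      ‖m‖ ≤ rc * (θBal F.L γ b₀ p₀ j / 4) → ‖m'‖ ≤ rc * (θBal F.L γ b₀ p₀ j / 4) →
      PlaqSmall (θBal F.L γ b₀ p₀ j / 4) U → PlaqSmall (θBal F.L γ b₀ p₀ j / 4) V → PlaqSmall (θBal F.L γ b₀ p₀ j / 4) W → PlaqSmall (θBal F.L γ b₀ p₀ j / 4) Y →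
      (∀ e, e ≠ B → V e = U e) → V B = U B * expPt m → (∀ e, e ≠ B' → W e = U e) → W B' = U B' * expPt m' →
      (∀ e, e ≠ B' → Y e = V e) → Y B' = V B' * expPt m' →
      ∀ (X Xw : GaugeField (F.P j) 0 ↥(Matrix.specialUnitaryGroup (Fin 2) ℂ)),
      (X = U ∨ X = V ∨ X = W ∨ X = Y) → (Xw = U ∨ Xw = V ∨ Xw = W ∨ Xw = Y) →
      PlaqSmall (θBal F.L γ b₀ p₀ Ts / 4 - 3 * (Db * rc)) (Φ (Xw, z)) →
      PlaqSmall (θBal F.L γ b₀ p₀ Ts / 4) (Φ (X, z)) := by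
  intro z B B' m m' U V W Y hm hm' hU hV hW hY hVoff hVon hWoff hWon hYoff hYon X Xw hX hXw hgood
  have hθ4 : 0 < θBal F.L γ b₀ p₀ j / 4 := by positivity
  have hq : θBal F.L γ b₀ p₀ j / 4 ≤ θBal F.L γ b₀ p₀ j := by linarith
  exact plaqSmall_corner_of_margin hθ4 hrc (fun X => Φ (X, z)) DP (hdisp z) hDb0 hDb hm hm'
    (plaqSmall_mono hq hU) (plaqSmall_mono hq hV) (plaqSmall_mono hq hW) (plaqSmall_mono hq hY) hVoff hVon hWoff hWon hYoff hYon hX hXw hgood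

/-- ★★ **GOOD-SET MARGIN, FAMILY POINTS (T³ record).**  Same binders plus the window guard `(1 + 16·√3·rc)·(θ_j∕4) ≤ θ_j` of ✓p819252 (it keeps the partial point
`U·e^{sm}@B` in the `θ_j`-window): for every `(s,t) ∈ [0,1]²`, `Φ(Xw, z) ∈ PlaqSmall (θBal_Ts∕4 − 3·(Db·rc))` at a corner `Xw` puts the image of the family point
`(U·e^{sm}@B)·e^{tm′}@B′` in `PlaqSmall (θBal_Ts∕4)` — the seed's window along the whole one-bond exponential square family at the good fibre points. [folklore] -/
theorem plaqSmall_family_of_good (F : T3Family) (γ b₀ p₀ : ℝ) (j Ts : ℕ)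
    {Z : Type} (Φ : GaugeField (F.P j) 0 ↥(Matrix.specialUnitaryGroup (Fin 2) ℂ) × Z → GaugeField (F.P Ts) 0 ↥(Matrix.specialUnitaryGroup (Fin 2) ℂ))
    (hθj : 0 < θBal F.L γ b₀ p₀ j) (Db rc : ℝ) (hrc : 0 ≤ rc) (hDb0 : 0 ≤ Db) (DP : Plaq (F.P Ts) 0 → PBond (F.P j) 0 → ℝ) (hDb : ∀ p b, DP p b ≤ Db)
    (hguard : (1 + 16 * Real.sqrt 3 * rc) * (θBal F.L γ b₀ p₀ j / 4) ≤ θBal F.L γ b₀ p₀ j)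
    (hdisp : ∀ (z : Z) (X : GaugeField (F.P j) 0 ↥(Matrix.specialUnitaryGroup (Fin 2) ℂ)), PlaqSmall (θBal F.L γ b₀ p₀ j) X →
      ∀ (b : PBond (F.P j) 0) (v : Fin 3 → ℝ), ‖v‖ ≤ rc * (θBal F.L γ b₀ p₀ j / 4) → ∀ s ∈ Icc (0 : ℝ) 1, ∀ p : Plaq (F.P Ts) 0,
        dist1 (GaugeField.plaqHol (Φ (update X b (X b * expPt (s • v)), z)) p)
          ≤ dist1 (GaugeField.plaqHol (Φ (X, z)) p) + DP p b * (‖v‖ / (θBal F.L γ b₀ p₀ j / 4))) :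
    ∀ (z : Z) (B B' : PBond (F.P j) 0) (m m' : Fin 3 → ℝ) (U V W Y : GaugeField (F.P j) 0 ↥(Matrix.specialUnitaryGroup (Fin 2) ℂ)),
      ‖m‖ ≤ rc * (θBal F.L γ b₀ p₀ j / 4) → ‖m'‖ ≤ rc * (θBal F.L γ b₀ p₀ j / 4) →
      PlaqSmall (θBal F.L γ b₀ p₀ j / 4) U → PlaqSmall (θBal F.L γ b₀ p₀ j / 4) V → PlaqSmall (θBal F.L γ b₀ p₀ j / 4) W → PlaqSmall (θBal F.L γ b₀ p₀ j / 4) Y →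
      (∀ e, e ≠ B → V e = U e) → V B = U B * expPt m → (∀ e, e ≠ B' → W e = U e) → W B' = U B' * expPt m' →
      (∀ e, e ≠ B' → Y e = V e) → Y B' = V B' * expPt m' →
      ∀ (Xw : GaugeField (F.P j) 0 ↥(Matrix.specialUnitaryGroup (Fin 2) ℂ)), (Xw = U ∨ Xw = V ∨ Xw = W ∨ Xw = Y) →
      ∀ s ∈ Icc (0 : ℝ) 1, ∀ t ∈ Icc (0 : ℝ) 1,
      PlaqSmall (θBal F.L γ b₀ p₀ Ts / 4 - 3 * (Db * rc)) (Φ (Xw, z)) →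
      PlaqSmall (θBal F.L γ b₀ p₀ Ts / 4) (Φ (update (update U B (U B * expPt (s • m))) B' ((update U B (U B * expPt (s • m))) B' * expPt (t • m')), z)) := by
  intro z B B' m m' U V W Y hm hm' hU hV hW hY hVoff hVon hWoff hWon hYoff hYon Xw hXw s hs t ht hgood
  have hθ4 : 0 < θBal F.L γ b₀ p₀ j / 4 := by positivity
  have hq : θBal F.L γ b₀ p₀ j / 4 ≤ θBal F.L γ b₀ p₀ j := by linarith
  -- the partial point `U·e^{sm}@B` stays in the `θ_j`-window (relational path from `U`, ✓`plaqSmall_relPath_of_le` + guard)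
  have hmid : PlaqSmall (θBal F.L γ b₀ p₀ j) (update U B (U B * expPt (s • m))) := by
    have h := plaqSmall_relPath_of_le (X := fun s => update U B (U B * expPt (s • m))) hU hm
      (fun s e he => update_of_ne he _ _) (fun s => update_self _ _ _) (abs_le_two_of_mem_Icc hs)
    exact plaqSmall_mono (guard8_of_guard16 hrc hθj.le hguard) h
  exact plaqSmall_family_of_margin hθ4 hrc (fun X => Φ (X, z)) DP (hdisp z) hDb0 hDb hm hm'
    (plaqSmall_mono hq hU) (plaqSmall_mono hq hV) (plaqSmall_mono hq hW) (plaqSmall_mono hq hY) hVoff hVon hWoff hWon hYoff hYon hs ht hmid hXw hgood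

end Summit.QuantumFields.YangMills.Theorems.OrganTangentGoodSetMargin

end
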